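import Summits.BirchSwinnertonDyer.BirchSwinnertonDyer.Theorems.GenusKolyvaginAtTwoEquivariantKolyvaginExactAtTwoSelmerDescentQuadratic
import Summits.BirchSwinnertonDyer.BirchSwinnertonDyer.Theorems.GenusKolyvaginAtTwoEquivariantKolyvaginExactAtTwoLemma53Rat
import Literature.NumberTheory.GaloisRepresentations.FrobeniusPlaces
import HarnessLib

/-!
# Route `GenusKolyvaginAtTwo`, LINE 6, KEY crux Q3 (inner statement of stmt-BirchSwinnertonDyer-22137):
# the Kolyvagin-prime dictionary `ℚ ⟷ K` for the STRICT local condition — `(c·x)_ℓ = 0` in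
# `H¹(ℚ_ℓ, E[2^M])` iff `(c·res x)_λ = 0` in `H¹(K_λ, E[2^M])`, `λ` the inert prime above `ℓ`

Helper (seat `bsd-line-gk2-p3` g12; `--supports` the crux, closes nothing). The pair descent of LINE 6
runs over `ℚ` (gk2-p2's `KolyvaginDescent.(Visible)SplitHypothesesM`, strict conditions `A ℓ`), while the
Kolyvagin relation at `2` (Q2 `KolyvaginRelationAtTwo`, stmt-24880: McCallum 1991 Prop. 4.4) is stated
over the Heegner field `K` at the place `λ ∣ ℓ`, with `torsionLocalKer` / `selmerLocalKer` over `K_λ`. This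
file is the transfer at a Gross–Kolyvagin prime `ℓ` (odd, good, `ℓ ∤ d_K`, INERT in `K`,
`Frob(ℓ) = Frob(∞)` on `ℚ(E[2^M])`, `Δ(E) < 0`): for a class `x ∈ H¹(ℚ, E[q])`, `q = 2^M`, Selmer at `ℓ`,
and any `c ∈ ℤ`,

  **`c·x ∈ torsionLocalKer_ℓ ⟺ c·(res x) ∈ torsionLocalKer_λ`**  (`zsmul_mem_torsionLocalKer_iff_resTorsion`).

This is the "local-field instantiation" left open by this lineage's `…InfResIndexTwo` (g10: `res :
H¹(ℚ_ℓ, E[2^M]) → H¹(K_λ, E[2^M])` is injective because `H¹(Gal(K_λ/ℚ_ℓ), E[2^M]) = 0`, `E[2^M]` being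
free of rank one over `ℤ/2^M[Frob_ℓ]`), obtained here WITHOUT local fields, through the two Frobenius
criteria of the tree: over `ℚ` (this lineage's `FrobeniusCriterion.zsmul_mem_torsionLocalKer_iff_norm`,
g11): `(c·x)_ℓ = 0 ⟺ c·[x, F²] = 0` for an arithmetic Frobenius `F` at `ℓ` acting on `E[q]` as a complex
conjugation; over `K` (Gross Prop. 9.6, `mem_torsionLocalKer_iff_h1Eval_eq_zero`): `(c·res x)_λ = 0 ⟺
c·[res x, F'] = 0` for an arithmetic Frobenius `F' ∈ Γ_K` at `λ`, which FIXES `E[q]`; and the link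
**`res F' = F²`** (`λ` has residue degree `2`: the tree's `isArithFrobAt_of_absGaloisRestrict_eq_pow`),
with `F² ∈ res(Γ_K)` because `F` permutes `±√d_K`.

* §1 (any `L/F`): `resTorsion_mem_unramifiedKer` — `res` carries "unramified at `ι⁻¹𝔔`" to "unramified
  at `𝔔`"; `resTorsion_mem_selmerLocalKer` — **`x` Selmer at `v` ⟹ `res x` Selmer at `w ∣ v`** (`v ∤ n`
  good; the converse of `…SelmerDescentUnramified`); `h1Eval_resTorsion_eq` — **`[res x, τ] = θ [x, res τ]`**
  for `τ` fixing `E_L[n]` (`θ : E[n](F̄) ≃ E_L[n](L̄)`), cocycle-independence on `Γ_{L(E[n])}`.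
* §2 (quadratic `K = ℚ(√c)`): `mem_range_absGaloisRestrict_of_forall_smul_eq` — an element of `Γ_ℚ`
  fixing every `e(θ)` lies in `res(Γ_K)`; `sq_mem_range_absGaloisRestrict_of_sq_eq` — **`g² ∈ res(Γ_K)`
  for EVERY `g ∈ Γ_ℚ`** (`(g·eθ)² = c` forces `g·eθ = ±eθ`).
* §3 the dictionary at a Gross–Kolyvagin prime (main theorem above), plus the packaged regular
  structure transported along conjugation (`exists_regular_generator_conj`).

THEOREMS ONLY (no definition, no named fact, no `sorry`, standard axioms). BSD is not proved by any of this.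

References: [McCallumLMS1991] §3 (3), §4 Prop. 4.4; [GrossLMS1991] §3 (3.2), §4, Prop. 9.6;
[NeukirchANT1999] I §9 (9.4)–(9.6); [SerreGaloisCohomology1997] I §2.6 (b).
-/

set_option autoImplicit false
set_option linter.dupNamespace false -- tree convention: `Summit.BirchSwinnertonDyer.BirchSwinnertonDyer.Theorems` (summit = sub-problem)

noncomputable section

open scoped Classical Pointwise

universe u

namespace Summit.BirchSwinnertonDyer.BirchSwinnertonDyer.Theorems.GenusExact.SelmerDescent

open WeierstrassCurve NumberField IsDedekindDomain Field
open Literature.NumberTheory.EllipticCurves Literature.NumberTheory.GaloisRepresentations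
open Summit.BirchSwinnertonDyer.BirchSwinnertonDyer.Theorems.GenusExact.FrobeniusCriterion

/-! ## §1 Restriction along `L/F`: unramified classes, Selmer classes, and the pairing `[x, ρ]` -/

section Res

variable {F : Type u} [Field F] [NumberField F] (W : WeierstrassCurve F) [W.IsElliptic]
variable (L : Type u) [Field L] [NumberField L] [Algebra F L]

omit [W.IsElliptic] in
/-- **`res` carries "unramified at `ι⁻¹ 𝔔`" to "unramified at `𝔔`"**: for `x ∈ H¹(F, E[n])` whose
restriction to the inertia group of the contracted prime `𝔔 ∩ \bar ℤ_F` is a coboundary, the restriction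
`res x ∈ H¹(L, E_L[n])` restricted to `I_𝔔` is a coboundary (`res (I_𝔔) ≤ I_{𝔔 ∩ \bar ℤ_F}`, transport
along the equivariant bijection `E[n](F̄) ≃ E_L[n](L̄)`). [cite: NeukirchANT1999, Ch. I §9 Prop. (9.4)] -/
theorem resTorsion_mem_unramifiedKer (n : ℤ) (𝔔 : Ideal (absIntegers (𝓞 L) L))
    {x : galH1Torsion W n}
    (hx : x ∈ unramifiedKer (geomTorsion W n) (𝔔.comap (absIntegersMap F L))) :
    resTorsion W L n x ∈ unramifiedKer (geomTorsion (W.baseChange L) n) 𝔔 := by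
  haveI : Algebra.IsAlgebraic F L := Algebra.IsAlgebraic.of_finite F L
  obtain ⟨φ, rfl⟩ :=
    oneCocycleClass_surjective (discreteTopRep (absoluteGaloisGroup F) (geomTorsion W n)) x
  rw [unramifiedKer, oneCocycleClass_mem_subgroupResKer_iff] at hx
  obtain ⟨a, ha⟩ := hx
  rw [resTorsion, resH1Hom_oneCocycleClass, unramifiedKer, oneCocycleClass_mem_subgroupResKer_iff]
  refine ⟨torsionBaseChangeEquiv L W n a, fun τ => ?_⟩
  have hτ : absGaloisRestrict F L (τ : absoluteGaloisGroup L) ∈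
      (𝔔.comap (absIntegersMap F L)).inertia (absoluteGaloisGroup F) :=
    absGaloisRestrict_mem_inertia_comap F L τ.2
  have h := ha ⟨_, hτ⟩
  rw [pullback_resHomOfEquivariant_apply]
  change torsionBaseChangeMap W L n (φ.1 (resGal (K := F) L τ)) = _
  change φ.1 (resGal (K := F) L τ) = resGal (K := F) L τ • a - a at h
  rw [h, map_sub, torsionBaseChangeMap_smul, torsionBaseChangeEquiv_apply]

variable (v : HeightOneSpectrum (𝓞 F)) (w : HeightOneSpectrum (𝓞 L)) [w.asIdeal.LiesOver v.asIdeal]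

/-- **`x` Selmer at `v` ⟹ `res x` Selmer at `w ∣ v`** at a good place `v ∤ n` (functoriality of the
Selmer local condition; the converse, under `I_𝔓 ≤ res Γ_L`, is
`mem_selmerLocalKer_of_resTorsion_mem_of_inertia_le`). [cite: McCallumLMS1991, §4 Lemma 4.3]
[cite: GrossLMS1991, §7 (7.1), (7.4)] -/
theorem resTorsion_mem_selmerLocalKer (n : ℤ) (hgood : W.HasGoodReductionAt v)
    (hn : (n : 𝓞 F) ∉ v.asIdeal) {x : galH1Torsion W n}
    (hx : x ∈ selmerLocalKer W (v.adicCompletion F) n) :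
    resTorsion W L n x ∈ selmerLocalKer (W.baseChange L) (w.adicCompletion L) n := by
  obtain ⟨𝔔, h𝔔⟩ := w.primesAbove_nonempty
  have hwv : w.asIdeal.under (𝓞 F) = v.asIdeal :=
    (Ideal.LiesOver.over (P := w.asIdeal) (p := v.asIdeal)).symm
  have h𝔓 : 𝔔.comap (absIntegersMap F L) ∈ v.primesAbove :=
    comap_absIntegersMap_mem_primesAbove hwv h𝔔
  rw [(W.baseChange L).selmerLocalKer_eq_unramifiedKer
    (hasGoodReductionAt_baseChange_of_hasGoodReductionAt W L v w hgood)
    (intCast_notMem_of_liesOver L v w hn) h𝔔]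
  rw [W.selmerLocalKer_eq_unramifiedKer hgood hn h𝔓] at hx
  exact resTorsion_mem_unramifiedKer W L n 𝔔 hx

omit [NumberField F] [NumberField L] [W.IsElliptic] in
/-- **`[res x, τ] = θ [x, res τ]` for `τ ∈ Γ_{L(E_L[n])}`**: the chosen cocycle of `res x` and the
pull-back of the chosen cocycle of `x` both represent `res x`, hence agree at every `τ` fixing `E_L[n]`
(`h1Eval_oneCocycleClass`); `θ = torsionBaseChangeMap`. [cite: SerreGaloisCohomology1997, I §2.4] -/
theorem h1Eval_resTorsion_eq [Algebra.IsAlgebraic F L] (n : ℤ) (x : galH1Torsion W n)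
    {τ : absoluteGaloisGroup L} (hτ : τ ∈ torsionFixing (W.baseChange L) n) :
    h1Eval (W.baseChange L) n (resTorsion W L n x) τ =
      torsionBaseChangeMap W L n (h1Eval W n x (resGal (K := F) L τ)) := by
  have hclass : resTorsion W L n x = oneCocycleClass _
      (contOneCocycles.pullback (resGal (K := F) L)
        (resHomOfEquivariant (resGal (K := F) L) (torsionBaseChangeMap W L n)
          (torsionBaseChangeMap_smul W L n)) (reprCocycle W n x)) := by
    conv_lhs => rw [← oneCocycleClass_reprCocycle W n x]
    rw [resTorsion, resH1Hom_oneCocycleClass]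
  rw [hclass, h1Eval_oneCocycleClass _ _ _ hτ, pullback_resHomOfEquivariant_apply]
  rfl

end Res

/-! ## §2 Quadratic fields: elements of `Γ_ℚ` fixing `√c`, and squares, lie in `res(Γ_K)` -/

section Quadratic

variable {K : Type} [Field K] [NumberField K]

/-- **An element of `Γ_ℚ` fixing `e(θ)` for every `ℚ`-embedding `e : K → ℚ̄` lies in `res(Γ_K)`**, for
`K = ℚ(θ)` quadratic: `res(Γ_K)` is the pointwise fixer of a copy `e(K)` (`exists_mem_range_absGaloisRestrict_iff`),
and the elements of `K` with `g·e(x) = e(x)` form a subalgebra containing `θ`, i.e. `K`.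
[cite: NeukirchANT1999, Ch. I §9 Prop. (9.6)] -/
theorem mem_range_absGaloisRestrict_of_forall_smul_eq (h2 : Module.finrank ℚ K = 2) {θ : K}
    (hθ : θ ∉ (algebraMap ℚ K).range) {g : absoluteGaloisGroup ℚ}
    (hg : ∀ e : K →ₐ[ℚ] AlgebraicClosure ℚ, g • e θ = e θ) :
    g ∈ (absGaloisRestrict ℚ K).toMonoidHom.range := by
  haveI : Algebra.IsAlgebraic ℚ K := Algebra.IsAlgebraic.of_finite ℚ K
  obtain ⟨e, he⟩ := exists_mem_range_absGaloisRestrict_iff ℚ K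
  change g ∈ (absGaloisRestrict ℚ K).range
  rw [he]
  let A : Subalgebra ℚ K :=
    { carrier := {x | g • e x = e x}
      mul_mem' := fun {a b} ha hb => by
        change g • e (a * b) = e (a * b)
        rw [map_mul, smul_mul', ha, hb]
      one_mem' := by
        change g • e 1 = e 1
        rw [map_one, smul_one]
      add_mem' := fun {a b} ha hb => by
        change g • e (a + b) = e (a + b)
        rw [map_add, smul_add, ha, hb]
      zero_mem' := by
        change g • e 0 = e 0
        rw [map_zero, smul_zero]
      algebraMap_mem' := fun q => by
        change g • e (algebraMap ℚ K q) = e (algebraMap ℚ K q)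
        rw [AlgHom.commutes, absoluteGaloisGroup.smul_def]
        exact AlgEquiv.commutes _ q }
  have hθA : θ ∈ A := hg e
  have hA : A = ⊤ :=
    top_le_iff.mp ((adjoin_simple_eq_top_of_finrank_eq_two h2 hθ).symm.le.trans
      (Algebra.adjoin_le (Set.singleton_subset_iff.mpr hθA)))
  intro x
  have hx : x ∈ A := by rw [hA]; exact Algebra.mem_top
  exact hx

/-- **Squares of `Γ_ℚ` lie in `res(Γ_K)` for `K = ℚ(√c)`**: for every `g ∈ Γ_ℚ` and every embedding
`e`, `(g·eθ)² = g·e(θ²) = c = (eθ)²`, so `g·eθ = ±eθ` and `g²·eθ = eθ`. (`Gal(K/ℚ)` has exponent `2`.)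
[cite: NeukirchANT1999, Ch. I §9] -/
theorem sq_mem_range_absGaloisRestrict_of_sq_eq (h2 : Module.finrank ℚ K = 2) {θ : K}
    (hθ : θ ∉ (algebraMap ℚ K).range) {c : ℤ} (hc : θ ^ 2 = algebraMap ℚ K c)
    (g : absoluteGaloisGroup ℚ) : g * g ∈ (absGaloisRestrict ℚ K).toMonoidHom.range := by
  refine mem_range_absGaloisRestrict_of_forall_smul_eq h2 hθ fun e => ?_
  have hfix : g • (algebraMap ℚ (AlgebraicClosure ℚ) c) = algebraMap ℚ (AlgebraicClosure ℚ) c := by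
    rw [absoluteGaloisGroup.smul_def]; exact AlgEquiv.commutes _ _
  have hsq : (g • e θ) ^ 2 = (e θ) ^ 2 := by
    rw [← smul_pow', ← map_pow, hc, AlgHom.commutes, hfix]
  rcases sq_eq_sq_iff_eq_or_eq_neg.mp hsq with h | h
  · rw [mul_smul, h, h]
  · rw [mul_smul, h, smul_neg, h, neg_neg]

end Quadratic

/-! ## §3 The dictionary at a Gross–Kolyvagin prime -/

section Dictionary

variable (W : WeierstrassCurve ℚ) [W.IsElliptic]

omit [W.IsElliptic] in
/-- **Regular structure transported along conjugation**: if `F` acts on `T = E[q]` as an involution and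
`T = ℤP ⊕ ℤ·FP` freely over `ℤ/2^M`, then `gFg⁻¹` is an involution on `T` and `T = ℤ(gP) ⊕ ℤ·(gFg⁻¹)(gP)`
freely. [folklore] -/
theorem exists_regular_generator_conj {q : ℕ} {M : ℕ} {F : absoluteGaloisGroup ℚ}
    {P : geomTorsion W (q : ℤ)} (hF : ∀ Q : geomTorsion W (q : ℤ), F • F • Q = Q)
    (hPM : (2 : ℤ) ^ M • P = 0)
    (hgen : ∀ Q : geomTorsion W (q : ℤ), ∃ x y : ℤ, Q = x • P + y • F • P)
    (hfree : ∀ x y : ℤ, x • P + y • F • P = 0 → (2 : ℤ) ^ M ∣ x ∧ (2 : ℤ) ^ M ∣ y)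
    (g : absoluteGaloisGroup ℚ) :
    (∀ Q : geomTorsion W (q : ℤ), (g * F * g⁻¹) • (g * F * g⁻¹) • Q = Q) ∧
      (2 : ℤ) ^ M • (g • P) = 0 ∧
      (∀ Q : geomTorsion W (q : ℤ), ∃ x y : ℤ, Q = x • (g • P) + y • (g * F * g⁻¹) • (g • P)) ∧
      (∀ x y : ℤ, x • (g • P) + y • (g * F * g⁻¹) • (g • P) = 0 →
        (2 : ℤ) ^ M ∣ x ∧ (2 : ℤ) ^ M ∣ y) := by
  have hconj : ∀ Q : geomTorsion W (q : ℤ), (g * F * g⁻¹) • Q = g • F • g⁻¹ • Q := fun Q => by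
    rw [mul_smul, mul_smul]
  refine ⟨fun Q => ?_, ?_, fun Q => ?_, fun x y h => ?_⟩
  · rw [hconj, hconj, inv_smul_smul, hF, smul_inv_smul]
  · rw [smul_comm, hPM, smul_zero]
  · obtain ⟨x, y, hxy⟩ := hgen (g⁻¹ • Q)
    refine ⟨x, y, ?_⟩
    rw [hconj, inv_smul_smul, ← smul_comm g x, ← smul_comm g y, ← smul_add, ← hxy, smul_inv_smul]
  · rw [hconj, inv_smul_smul, ← smul_comm g x, ← smul_comm g y, ← smul_add] at h
    have h0 : x • P + y • F • P = 0 := by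
      have h' := congrArg (fun Q => g⁻¹ • Q) h
      simpa only [inv_smul_smul, smul_zero] using h'
    exact hfree x y h0

variable {K : Type} [Field K] [NumberField K]

/-- **The Kolyvagin-prime dictionary `ℚ ⟷ K` for the strict local condition.** Let `E = W/ℚ` be elliptic
with `Δ(E) < 0`, `q = 2^M` (`M ≥ 1`); `K = ℚ(θ)` quadratic (`[K : ℚ] = 2`, `θ ∉ ℚ`, `θ² = c ∈ ℤ`); `ℓ` an
odd prime at the place `v` of good reduction, of residue degree `2` in `K` (`λ ∣ v` with
`f(λ|v) = 2`: `ℓ` INERT, in particular `ℓ ∤ c`), and a Gross–Kolyvagin prime of depth `M` (`Frob(ℓ) = Frob(∞)` on `ℚ(E[q])`,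
`FrobEqFrobInfty W K q ℓ`). Let `x ∈ H¹(ℚ, E[q])` satisfy the Selmer condition at `ℓ`. Then for every
`c' ∈ ℤ`: **`c'·x ∈ torsionLocalKer_ℓ(E/ℚ) ⟺ c'·res x ∈ torsionLocalKer_λ(E/K)`** (`(c'x)_ℓ = 0` in
`H¹(ℚ_ℓ, E[q])` iff `(c'·res x)_λ = 0` in `H¹(K_λ, E[q])`). Proof: with `F` an arithmetic Frobenius at the
prime `ι⁻¹𝔔₀ ∣ ℓ` below the `K_λ`-chosen prime `𝔔₀`, acting on `E[q]` as a complex conjugation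
(`FrobEqFrobInfty.exists_at`), `F² = res F'` for an arithmetic Frobenius `F' ∈ Γ_K` at `𝔔₀` fixing `E[q]`
(§2 and `isArithFrobAt_of_absGaloisRestrict_eq_pow`, `f = 2`); over `K`, `(c'·res x)_λ = 0 ⟺
c'·[res x, F'] = 0` (Gross Prop. 9.6) and `[res x, F'] = θ[x, F²]` (§1); over `ℚ`, at the `ℚ_ℓ`-chosen prime
`𝔓₀ = g·ι⁻¹𝔔₀` with the Frobenius `gFg⁻¹`, `(c'x)_ℓ = 0 ⟺ c'·[x, gF²g⁻¹] = 0`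
(`zsmul_mem_torsionLocalKer_iff_norm`: `E[q]` is free of rank one over `ℤ/2^M[F]` on `Δ < 0`), and
`[x, gF²g⁻¹] = g·[x, F²]`. [cite: GrossLMS1991, §3 (3.2), §4 and Prop. 9.6]
[cite: McCallumLMS1991, §3 (3) and §4 Prop. 4.4] [cite: SerreGaloisCohomology1997, I §2.6 (b)] -/
theorem zsmul_mem_torsionLocalKer_iff_resTorsion (hΔ : W.Δ < 0) {M : ℕ} (hM : 1 ≤ M) {q : ℕ}
    (hq : q = 2 ^ M) {ℓ : ℕ} (hℓ : ℓ.Prime) (hℓ2 : ℓ ≠ 2) {v : HeightOneSpectrum (𝓞 ℚ)}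
    (hℓv : (ℓ : 𝓞 ℚ) ∈ v.asIdeal) (hgood : W.HasGoodReductionAt v)
    (h2K : Module.finrank ℚ K = 2) {θ : K} (hθ : θ ∉ (algebraMap ℚ K).range) {c : ℤ}
    (hc : θ ^ 2 = algebraMap ℚ K c) (hℓM : FrobEqFrobInfty W K q ℓ)
    (w : HeightOneSpectrum (𝓞 K)) [w.asIdeal.LiesOver v.asIdeal] (hf : w.asIdeal.inertiaDeg (𝓞 ℚ) = 2)
    {x : galH1Torsion W (q : ℤ)} (hxSel : x ∈ selmerLocalKer W (v.adicCompletion ℚ) (q : ℤ))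
    (c' : ℤ) :
    c' • x ∈ W.torsionLocalKer (v.adicCompletion ℚ) (q : ℤ) ↔
      c' • resTorsion W K (q : ℤ) x ∈
        (W.baseChange K).torsionLocalKer (w.adicCompletion K) (q : ℤ) := by
  subst hq
  haveI : Algebra.IsAlgebraic ℚ K := Algebra.IsAlgebraic.of_finite ℚ K
  -- ### Step 0: bookkeeping at `v` and `w`
  have h2v' : ((2 : ℕ) : 𝓞 ℚ) ∉ v.asIdeal := two_notMem_of_odd_prime_mem hℓ hℓ2 hℓv
  have h2v : (2 : 𝓞 ℚ) ∉ v.asIdeal := by exact_mod_cast h2v'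
  have hqv' : ((2 ^ M : ℕ) : 𝓞 ℚ) ∉ v.asIdeal := by
    rw [Nat.cast_pow]
    exact fun h ↦ h2v' (v.isPrime.mem_of_pow_mem M h)
  have hqv : ((((2 ^ M : ℕ) : ℤ)) : 𝓞 ℚ) ∉ v.asIdeal := by rwa [Int.cast_natCast]
  have hq0 : (2 ^ M : ℕ) ≠ 0 := pow_ne_zero M two_ne_zero
  have hq0Z : ((2 ^ M : ℕ) : ℤ) ≠ 0 := by exact_mod_cast hq0
  have hvbad : v ∉ W.badPlaces (𝓞 ℚ) := fun h ↦ h hgood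
  have hwv : w.asIdeal.under (𝓞 ℚ) = v.asIdeal :=
    (Ideal.LiesOver.over (P := w.asIdeal) (p := v.asIdeal)).symm
  have hgoodK : (W.baseChange K).HasGoodReductionAt w :=
    hasGoodReductionAt_baseChange_of_hasGoodReductionAt W K v w hgood
  have hwbad : w ∉ (W.baseChange K).badPlaces (𝓞 K) := fun h ↦ h hgoodK
  have hqw : ((((2 ^ M : ℕ) : ℤ)) : 𝓞 K) ∉ w.asIdeal := intCast_notMem_of_liesOver K v w hqv
  -- ### Step 1: the primes — `𝔔₀` (chosen for `K_λ`), `𝔓₁ = ι⁻¹𝔔₀`, `𝔓₀` (chosen for `ℚ_ℓ`)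
  obtain ⟨𝔐K, h𝔐K⟩ := w.localPrimesAbove_nonempty
  set 𝔔₀ := w.primeBelow (closureEmb (K := K) (w.adicCompletion K)) 𝔐K with h𝔔₀def
  have h𝔔₀ : 𝔔₀ ∈ w.primesAbove := HeightOneSpectrum.primeBelow_mem_primesAbove h𝔐K
  set 𝔓₁ := 𝔔₀.comap (absIntegersMap ℚ K) with h𝔓₁def
  have h𝔓₁ : 𝔓₁ ∈ v.primesAbove := comap_absIntegersMap_mem_primesAbove hwv h𝔔₀
  obtain ⟨𝔐, h𝔐⟩ := v.localPrimesAbove_nonempty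
  set 𝔓₀ := v.primeBelow (closureEmb (K := ℚ) (v.adicCompletion ℚ)) 𝔐 with h𝔓₀def
  have h𝔓₀ : 𝔓₀ ∈ v.primesAbove := HeightOneSpectrum.primeBelow_mem_primesAbove h𝔐
  haveI : 𝔓₀.IsPrime := h𝔓₀.1
  haveI : 𝔓₁.IsPrime := h𝔓₁.1
  -- ### Step 2: a Frobenius `F` at `𝔓₁` acting on `E[q]` as a complex conjugation `c₁`; regular structure
  obtain ⟨F, c₁, hFrob, hc₁, hE, -⟩ := FrobEqFrobInfty.exists_at (W := W) (K := K) hℓ hℓM hℓv h𝔓₁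
  obtain ⟨P, hPM, hgen, hfree⟩ := exists_regular_generator_of_Δ_neg W hΔ hc₁ hM
  have hgenF : ∀ Q : geomTorsion W ((2 ^ M : ℕ) : ℤ), ∃ a b : ℤ, Q = a • P + b • F • P := by
    intro Q; rw [hE P]; exact hgen Q
  have hfreeF : ∀ a b : ℤ, a • P + b • F • P = 0 → (2 : ℤ) ^ M ∣ a ∧ (2 : ℤ) ^ M ∣ b := by
    intro a b h; rw [hE P] at h; exact hfree a b h
  have hFF : ∀ Q : geomTorsion W ((2 ^ M : ℕ) : ℤ), F • F • Q = Q := fun Q ↦ by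
    rw [hE, hE, ← mul_smul, ← pow_two, hc₁.sq_eq_one, one_smul]
  have hF2fix : F * F ∈ torsionFixing W ((2 ^ M : ℕ) : ℤ) := by
    rw [mem_torsionFixing_iff]
    intro Q
    rw [mul_smul, hFF]
  -- ### Step 3: `F² = res F'` with `F'` an arithmetic Frobenius at `𝔔₀` fixing `E_K[q]`
  obtain ⟨F', hF'⟩ := sq_mem_range_absGaloisRestrict_of_sq_eq h2K hθ hc F
  have hresF' : absGaloisRestrict ℚ K F' = F * F := hF'
  have hresF'' : resGal (K := ℚ) K F' = F * F := hresF'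
  have hFrob' : IsArithFrobAt (𝓞 K) F' 𝔔₀ :=
    isArithFrobAt_of_absGaloisRestrict_eq_pow hwv h𝔔₀ hFrob (by rw [hresF', hf, pow_two])
  have hF'fix : F' ∈ torsionFixing (W.baseChange K) ((2 ^ M : ℕ) : ℤ) := by
    rw [mem_torsionFixing_iff]
    intro Q
    obtain ⟨P₀, rfl⟩ := (torsionBaseChangeMap_bijective K W ((2 ^ M : ℕ) : ℤ)).2 Q
    rw [← torsionBaseChangeMap_smul, hresF'', mul_smul, hFF]
  -- ### Step 4: the two criteria
  -- (K side) `(c'·res x)_λ = 0 ⟺ [c'·res x, F'] = 0`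
  have hIK : 𝔔₀.inertia (absoluteGaloisGroup K) ≤ torsionFixing (W.baseChange K) ((2 ^ M : ℕ) : ℤ) :=
    inertia_le_torsionFixing (W.baseChange K) hwbad hqw _ h𝔐K
  have hopenK := isOpen_torsionFixing (W.baseChange K) hq0Z
  haveI : CharZero (w.adicCompletion K) :=
    charZero_of_injective_algebraMap (algebraMap K (w.adicCompletion K)).injective
  have hsurjK : Function.Surjective
      (torsionPointsMap (W.baseChange K) (w.adicCompletion K) ((2 ^ M : ℕ) : ℤ)) :=
    (torsionPointsMap_bijective (W.baseChange K) (w.adicCompletion K) hq0).2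
  have hySel : resTorsion W K ((2 ^ M : ℕ) : ℤ) x ∈
      selmerLocalKer (W.baseChange K) (w.adicCompletion K) ((2 ^ M : ℕ) : ℤ) :=
    resTorsion_mem_selmerLocalKer W K v w _ hgood hqv hxSel
  have hyunr : c' • resTorsion W K ((2 ^ M : ℕ) : ℤ) x ∈
      unramifiedKer (geomTorsion (W.baseChange K) ((2 ^ M : ℕ) : ℤ)) 𝔔₀ := by
    rw [← (W.baseChange K).selmerLocalKer_eq_unramifiedKer hgoodK hqw h𝔔₀]
    exact AddSubgroup.zsmul_mem _ hySel c'
  have hKcrit := mem_torsionLocalKer_iff_h1Eval_eq_zero (W.baseChange K) ((2 ^ M : ℕ) : ℤ) h𝔐K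
    hFrob' hF'fix hIK hopenK hsurjK hyunr
  -- (ℚ side) at `𝔓₀ = g • 𝔓₁` with the Frobenius `g F g⁻¹`
  obtain ⟨g, hg⟩ := HeightOneSpectrum.exists_smul_eq_of_mem_primesAbove_holds h𝔓₁ h𝔓₀
  have hFrob₀ : IsArithFrobAt (𝓞 ℚ) (g * F * g⁻¹) 𝔓₀ := hg ▸ hFrob.conj g
  obtain ⟨hFF₀, hPM₀, hgen₀, hfree₀⟩ := exists_regular_generator_conj W hFF hPM hgenF hfreeF g
  have hIQ : 𝔓₀.inertia (absoluteGaloisGroup ℚ) ≤ torsionFixing W ((2 ^ M : ℕ) : ℤ) :=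
    inertia_le_torsionFixing W hvbad hqv _ h𝔐
  have hopenQ := isOpen_torsionFixing W hq0Z
  have hxunr : x ∈ unramifiedKer (geomTorsion W ((2 ^ M : ℕ) : ℤ)) 𝔓₀ := by
    rw [← W.selmerLocalKer_eq_unramifiedKer hgood hqv h𝔓₀]; exact hxSel
  -- the `ℚ`-algebra structure on `ℚ_v` is the canonical `instAlgebraAdicCompletion` (fed by unification;
  -- `CharZero ℚ_v` is introduced only now, cf. the `DivisionRing.toRatAlgebra` diamond)
  haveI : CharZero (v.adicCompletion ℚ) :=
    charZero_of_injective_algebraMap (algebraMap ℚ (v.adicCompletion ℚ)).injective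
  have hsurjQ : Function.Surjective (@torsionPointsMap ℚ _ W (v.adicCompletion ℚ) _
      (HeightOneSpectrum.instAlgebraAdicCompletion (𝓞 ℚ) ℚ v) ((2 ^ M : ℕ) : ℤ)) :=
    (@torsionPointsMap_bijective ℚ _ _ W _ (v.adicCompletion ℚ) _
      (HeightOneSpectrum.instAlgebraAdicCompletion (𝓞 ℚ) ℚ v) _ (2 ^ M) hq0).2
  have hQcrit := zsmul_mem_torsionLocalKer_iff_norm W h𝔐 hFrob₀ hIQ hopenQ hsurjQ hFF₀ hPM₀ hgen₀
    hfree₀ hxunr c'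
  -- ### Step 5: the link `[x, gF²g⁻¹] = g·[x, F²]`, `[res x, F'] = θ[x, F²]`
  have hnorm : h1Eval W ((2 ^ M : ℕ) : ℤ) x (g * F * g⁻¹) +
      (g * F * g⁻¹) • h1Eval W ((2 ^ M : ℕ) : ℤ) x (g * F * g⁻¹) =
        g • h1Eval W ((2 ^ M : ℕ) : ℤ) x (F * F) := by
    rw [← h1Eval_mul_smul, show g * F * g⁻¹ * (g * F * g⁻¹) = g * (F * F) * g⁻¹ by group,
      h1Eval_conj W ((2 ^ M : ℕ) : ℤ) x g hF2fix]
  have hθeval : h1Eval (W.baseChange K) ((2 ^ M : ℕ) : ℤ) (c' • resTorsion W K ((2 ^ M : ℕ) : ℤ) x) F' =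
      torsionBaseChangeMap W K ((2 ^ M : ℕ) : ℤ) (c' • h1Eval W ((2 ^ M : ℕ) : ℤ) x (F * F)) := by
    rw [h1Eval_zsmul _ _ _ _ hF'fix, h1Eval_resTorsion_eq W K _ x hF'fix, hresF'', map_zsmul]
  rw [hQcrit, hKcrit, hnorm, hθeval, smul_comm c' g, smul_eq_zero_iff_eq,
    map_eq_zero_iff _ (torsionBaseChangeMap_injective W K _)]

/-- **The dictionary WITHOUT the Selmer hypothesis** (`ℓ ∤ c` explicit): for EVERY `x ∈ H¹(ℚ, E[q])` and
`c'`: `c'·x ∈ torsionLocalKer_ℓ ⟺ c'·res x ∈ torsionLocalKer_λ` — both sides force `c'·x` Selmer at `ℓ`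
(`torsionLocalKer ≤ selmerLocalKer`, and `mem_selmerLocalKer_of_resTorsion_mem_quadratic` on the `K` side);
covers the ramified class `c_M(mℓ)` of Prop. 4.4. [cite: McCallumLMS1991, §4 Prop. 4.4] [cite: GrossLMS1991, Prop. 9.6] -/
theorem zsmul_mem_torsionLocalKer_iff_resTorsion_of_notMem (hΔ : W.Δ < 0) {M : ℕ} (hM : 1 ≤ M) {q : ℕ}
    (hq : q = 2 ^ M) {ℓ : ℕ} (hℓ : ℓ.Prime) (hℓ2 : ℓ ≠ 2) {v : HeightOneSpectrum (𝓞 ℚ)}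
    (hℓv : (ℓ : 𝓞 ℚ) ∈ v.asIdeal) (hgood : W.HasGoodReductionAt v)
    (h2K : Module.finrank ℚ K = 2) {θ : K} (hθ : θ ∉ (algebraMap ℚ K).range) {c : ℤ}
    (hc : θ ^ 2 = algebraMap ℚ K c) (hcv : ((c : ℤ) : 𝓞 ℚ) ∉ v.asIdeal) (hℓM : FrobEqFrobInfty W K q ℓ)
    (w : HeightOneSpectrum (𝓞 K)) [w.asIdeal.LiesOver v.asIdeal] (hf : w.asIdeal.inertiaDeg (𝓞 ℚ) = 2)
    (x : galH1Torsion W (q : ℤ)) (c' : ℤ) :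
    c' • x ∈ W.torsionLocalKer (v.adicCompletion ℚ) (q : ℤ) ↔
      c' • resTorsion W K (q : ℤ) x ∈
        (W.baseChange K).torsionLocalKer (w.adicCompletion K) (q : ℤ) := by
  have h2v' : ((2 : ℕ) : 𝓞 ℚ) ∉ v.asIdeal := two_notMem_of_odd_prime_mem hℓ hℓ2 hℓv
  have hqv : ((q : ℤ) : 𝓞 ℚ) ∉ v.asIdeal := by
    rw [Int.cast_natCast, hq, Nat.cast_pow]; exact fun h ↦ h2v' (v.isPrime.mem_of_pow_mem M h)
  have key : c' • x ∈ selmerLocalKer W (v.adicCompletion ℚ) (q : ℤ) →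
      (c' • x ∈ W.torsionLocalKer (v.adicCompletion ℚ) (q : ℤ) ↔
        c' • resTorsion W K (q : ℤ) x ∈
          (W.baseChange K).torsionLocalKer (w.adicCompletion K) (q : ℤ)) := fun hsel ↦ by
    have h := zsmul_mem_torsionLocalKer_iff_resTorsion W hΔ hM hq hℓ hℓ2 hℓv hgood h2K hθ hc hℓM w hf
      hsel 1
    rwa [one_zsmul, map_zsmul, one_zsmul] at h
  refine ⟨fun h ↦ (key (W.torsionLocalKer_le_selmerLocalKer _ _ h)).mp h, fun h ↦ (key ?_).mpr h⟩
  refine mem_selmerLocalKer_of_resTorsion_mem_quadratic W h2K hθ hc (q : ℤ) v w hgood hqv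
    (by exact_mod_cast h2v') hcv ?_
  rw [map_zsmul]
  exact (W.baseChange K).torsionLocalKer_le_selmerLocalKer _ _ h

end Dictionary

end Summit.BirchSwinnertonDyer.BirchSwinnertonDyer.Theorems.GenusExact.SelmerDescent

end
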